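import Literature.NumberTheory.LFunctions.Zhang2022.DetectorShiftAdmissible

/-!
# Zhang (2022), programme F-S3 (cell landau-siegel §E, seat ls-barrier-num): Lemma 2.3's sign-admissible box IS
# «the bulk symbol of the shift-detector form is non-negative on the integer lattice»

Y. Zhang, *Discrete mean estimates and the Landau–Siegel zero*, arXiv:2211.02515v1 [Zhang2022LandauSiegel] —
an unrefereed manuscript under adjudication. **WHAT THIS IS NOT: not a claim about Theorems 1–2 of
arXiv:2211.02515, about Landau–Siegel zeros, or about Parity; nothing here asserts any claim of the manuscript.
The programme SEARCHES and TYPES; no claim about Landau–Siegel zeros, Theorems 1–2 of arXiv:2211.02515 or a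
repaired Margin232 until a kernel theorem says so.**

The one-sided main-term form of the three-shift recipe `Det.shiftRecipe b` (`DetectorMainTermForm`) has, in the tail
primitive `S = ∫_y^1 g`, the bulk part `c₀(b)·T_b(S)`, `T_b(S) = ‖S″‖² + πe₁Im⟨S″,S′⟩ + π²e₂‖S′‖² + π³e₃Im⟨S′,S⟩`
(`e₁,e₂,e₃` the elementary symmetric functions of `b`; cell memo barrier/num/SHIFT-PSD.md §0.2), whose symbol on the
exponential `e^{iπηy}` is `π⁴σ_b(η)`, `σ_b(η) = η⁴ + e₁η³ + e₂η² + e₃η = η(η+b₀)(η+b₁)(η+b₂)`. By Parseval on the circle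
of length `2`, the CLAMPED bulk form on an interval of length `2` is `2π⁴Σ_{m∈ℤ} σ_b(m)|ĉ_m|²`; the cell's DOUBLING
IDENTITY (memo H-CLOSED-FORM.md §10: Zhang's free-end boundary matrix equals `c₀(b)` times the clamped mirror-half
energy, numerically exact) turns the one-sided form on `[0,1]` into exactly that clamped form on `[−1,1]`. So the
positivity of the detector's main-term form on the whole one-sided class reduces to `c₀(b) > 0`
(`Det.re_sum_shiftW_pos`) and to the sign of `σ_b` ON THE INTEGERS — which is what THIS FILE settles, as pure
arithmetic:

* `latticeSymbol b m := m(m+b₀)(m+b₁)(m+b₂)` and `latticeSymbol_eq` (= `m⁴ + e₁m³ + e₂m² + e₃m`);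
* **`latticeSymbol_nonneg`** — for a sign-admissible `b` (`0 < b₀ < b₁ < b₂`, `b₀ ≤ 1`, `[b₁,b₂] ⊂ [k,k+1]`),
  `σ_b(m) ≥ 0` for EVERY integer `m` (no integer lies strictly inside `(−b₀,0) ∪ (−b₂,−b₁)`);
* **`signAdmissible_iff_latticeSymbol_nonneg`** — conversely, for a sorted positive triple, `σ_b(m) ≥ 0` for all
  integers `m` FORCES `b₀ ≤ 1` (`m = −1`) and `[b₁, b₂]` inside one unit gap (`m = −n` for an integer `n` strictly
  between them): Lemma 2.3's box `Det.SignAdmissible` is EXACTLY «sorted, positive, and symbol `≥ 0` on `ℤ`».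

Elementary; standard axioms; no analysis. (The Parseval step and the doubling identity are NOT in this file.)
References: Y. Zhang, arXiv:2211.02515v1 (2022), §2 Lemma 2.3, (2.13) [p. 9]; Prop. 7.1, (8.11)–(8.23) [pp. 44–50].
[cite: Zhang2022LandauSiegel, §2 Lemma 2.3]
-/

noncomputable section

open Real Set

namespace Literature.NumberTheory.LFunctions.Zhang2022

namespace Det

/-- The bulk symbol of the three-shift form on the lattice point `m`: `σ_b(m) = m(m+b₀)(m+b₁)(m+b₂)`.
[cite: Zhang2022LandauSiegel, §2 Lemma 2.3; Prop 7.1 (8.11)–(8.23)] -/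
def latticeSymbol (b : Fin 3 → ℝ) (m : ℤ) : ℝ := (m : ℝ) * ((m : ℝ) + b 0) * (((m : ℝ) + b 1) * ((m : ℝ) + b 2))

/-- `σ_b(m) = m⁴ + e₁m³ + e₂m² + e₃m` with `e₁ = Σb_j`, `e₂ = Σ_{i<j} b_ib_j`, `e₃ = b₀b₁b₂` — the symbol of
`‖S″‖² + πe₁Im⟨S″,S′⟩ + π²e₂‖S′‖² + π³e₃Im⟨S′,S⟩` at frequency `m` (units of `π`). [cite: Zhang2022LandauSiegel, Prop 7.1 (8.11)–(8.23)] -/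
theorem latticeSymbol_eq (b : Fin 3 → ℝ) (m : ℤ) :
    latticeSymbol b m = (m : ℝ) ^ 4 + (b 0 + b 1 + b 2) * (m : ℝ) ^ 3
      + (b 0 * b 1 + b 1 * b 2 + b 2 * b 0) * (m : ℝ) ^ 2 + (b 0 * b 1 * b 2) * (m : ℝ) := by
  unfold latticeSymbol; ring

/-- **Sign-admissible ⇒ the symbol is `≥ 0` at every integer.** For `m ≥ 0` every factor is `≥ 0`; for `m ≤ −1`,
`m(m+b₀) ≥ 0` because `b₀ ≤ 1`, and `(m+b₁)(m+b₂) ≥ 0` because no integer lies strictly between `b₁` and `b₂`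
(`m ≥ −k` or `m ≤ −(k+1)`). [cite: Zhang2022LandauSiegel, §2 Lemma 2.3] -/
theorem latticeSymbol_nonneg {b : Fin 3 → ℝ} (hb : SignAdmissible b) (m : ℤ) : 0 ≤ latticeSymbol b m := by
  obtain ⟨h0, h01, h12, hle1, k, hk1, hk2⟩ := hb
  unfold latticeSymbol
  rcases le_or_gt 0 m with hm | hm
  · have hmR : (0:ℝ) ≤ m := by exact_mod_cast hm
    have h1 : 0 ≤ (m:ℝ) + b 0 := by linarith
    have h2 : 0 ≤ (m:ℝ) + b 1 := by linarith
    have h3 : 0 ≤ (m:ℝ) + b 2 := by linarith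
    positivity
  · have hm1 : m ≤ -1 := by omega
    have hmR : (m:ℝ) ≤ -1 := by exact_mod_cast hm1
    have hA : 0 ≤ (m:ℝ) * ((m:ℝ) + b 0) := by
      have : (m:ℝ) + b 0 ≤ 0 := by linarith
      nlinarith
    have hB : 0 ≤ ((m:ℝ) + b 1) * ((m:ℝ) + b 2) := by
      rcases le_or_gt (-(k:ℤ)) m with hmk | hmk
      · have : (-(k:ℝ)) ≤ m := by exact_mod_cast hmk
        have h2 : 0 ≤ (m:ℝ) + b 1 := by linarith
        have h3 : 0 ≤ (m:ℝ) + b 2 := by linarith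
        positivity
      · have hmk' : m ≤ -(k:ℤ) - 1 := by omega
        have : (m:ℝ) ≤ -(k:ℝ) - 1 := by exact_mod_cast hmk'
        have h2 : (m:ℝ) + b 1 ≤ 0 := by linarith
        have h3 : (m:ℝ) + b 2 ≤ 0 := by linarith
        nlinarith
    exact mul_nonneg hA hB

/-- **The converse: lattice non-negativity forces the box.** For a sorted positive triple, `σ_b(m) ≥ 0` for all
integers `m` implies `b₀ ≤ 1` and `[b₁,b₂] ⊂ [k, k+1]` for some `k ∈ ℕ`; together with `latticeSymbol_nonneg`:
`Det.SignAdmissible b ↔ 0 < b₀ < b₁ < b₂ ∧ ∀ m ∈ ℤ, σ_b(m) ≥ 0`. [cite: Zhang2022LandauSiegel, §2 Lemma 2.3] -/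
theorem signAdmissible_iff_latticeSymbol_nonneg (b : Fin 3 → ℝ) :
    SignAdmissible b ↔ (0 < b 0 ∧ b 0 < b 1 ∧ b 1 < b 2 ∧ ∀ m : ℤ, 0 ≤ latticeSymbol b m) := by
  constructor
  · intro hb
    exact ⟨hb.1, hb.2.1, hb.2.2.1, latticeSymbol_nonneg hb⟩
  · rintro ⟨h0, h01, h12, hσ⟩
    have h02 : b 0 < b 2 := h01.trans h12
    -- b₀ ≤ 1 from m = -1
    have hle1 : b 0 ≤ 1 := by
      by_contra hgt
      push Not at hgt
      have h := hσ (-1)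
      unfold latticeSymbol at h
      push_cast at h
      have p1 : 0 < (-1:ℝ) + b 0 := by linarith
      have p2 : 0 < (-1:ℝ) + b 1 := by linarith
      have p3 : 0 < (-1:ℝ) + b 2 := by linarith
      have : (-1:ℝ) * ((-1:ℝ) + b 0) * (((-1:ℝ) + b 1) * ((-1:ℝ) + b 2)) < 0 := by
        have := mul_pos p1 (mul_pos p2 p3)
        nlinarith
      linarith
    -- no integer strictly between b₁ and b₂
    have hgap : ∀ n : ℤ, ¬ (b 1 < n ∧ (n:ℝ) < b 2) := by
      rintro n ⟨hn1, hn2⟩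
      have hnpos : (0:ℝ) < n := (h0.trans h01).trans hn1
      have hn1' : (1:ℤ) ≤ n := by
        have : (0:ℤ) < n := by exact_mod_cast hnpos
        omega
      -- in fact n ≥ 2 is not needed: use b₀ ≤ 1 < n or handle n = 1 via b₁ > b₀
      have h := hσ (-n)
      unfold latticeSymbol at h
      push_cast at h
      have q1 : (-(n:ℝ)) < 0 := by linarith
      have q2 : (-(n:ℝ)) + b 0 < 0 := by linarith
      have q3 : (-(n:ℝ)) + b 1 < 0 := by linarith
      have q4 : 0 < (-(n:ℝ)) + b 2 := by linarith
      have hA : 0 < (-(n:ℝ)) * ((-(n:ℝ)) + b 0) := mul_pos_of_neg_of_neg q1 q2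
      have hB : ((-(n:ℝ)) + b 1) * ((-(n:ℝ)) + b 2) < 0 := mul_neg_of_neg_of_pos q3 q4
      have : (-(n:ℝ)) * ((-(n:ℝ)) + b 0) * (((-(n:ℝ)) + b 1) * ((-(n:ℝ)) + b 2)) < 0 := mul_neg_of_pos_of_neg hA hB
      linarith
    refine ⟨h0, h01, h12, hle1, ⌊b 1⌋.toNat, ?_, ?_⟩
    · have hfl : ((⌊b 1⌋ : ℤ) : ℝ) ≤ b 1 := Int.floor_le _
      have hnn : 0 ≤ ⌊b 1⌋ := Int.floor_nonneg.mpr (h0.trans h01).le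
      have : ((⌊b 1⌋.toNat : ℕ) : ℝ) = ((⌊b 1⌋ : ℤ) : ℝ) := by exact_mod_cast Int.toNat_of_nonneg hnn
      rw [this]; exact hfl
    · have hnn : 0 ≤ ⌊b 1⌋ := Int.floor_nonneg.mpr (h0.trans h01).le
      have hcast : ((⌊b 1⌋.toNat : ℕ) : ℝ) = ((⌊b 1⌋ : ℤ) : ℝ) := by exact_mod_cast Int.toNat_of_nonneg hnn
      rw [hcast]
      by_contra hgt
      push Not at hgt
      -- then n = ⌊b₁⌋ + 1 lies strictly between b₁ and b₂
      have hlt : b 1 < ((⌊b 1⌋ + 1 : ℤ) : ℝ) := by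
        have := Int.lt_floor_add_one (b 1); push_cast at this ⊢; exact this
      exact hgap (⌊b 1⌋ + 1) ⟨hlt, by push_cast; linarith⟩

/-- At the printed detector `(1,2,3)` the symbol VANISHES at `m ∈ {0,−1,−2,−3}` and is positive elsewhere — the
four-dimensional bulk kernel behind the tree's `mainTermForm_eq_zero_iff_afeSpan` (frequencies `1, e^{−iπy}, e^{−2iπy},
e^{−3iπy}`). [cite: Zhang2022LandauSiegel, Prop 7.1 p.44] -/
theorem latticeSymbol_std (m : ℤ) :
    latticeSymbol ![1, 2, 3] m = (m : ℝ) * ((m:ℝ) + 1) * (((m:ℝ) + 2) * ((m:ℝ) + 3)) := by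
  simp [latticeSymbol]

end Det

end Literature.NumberTheory.LFunctions.Zhang2022
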